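import Literature.MathematicalPhysics.QuantumFieldTheory.Balaban1983to89.B9SectBL2GFrameCodedY
import Literature.MathematicalPhysics.QuantumFieldTheory.Balaban1983to89.B9SectBQSizesY

/-!
# `Balaban1983to89.B9SectBQSizesL2Y` — THE WEIGHT LETTER `a∕vol` IN BLOCK-`ℓ²` AT NODE 00's LETTERS: the displayed law `L2SizeAb` of gen 14's
# `l2GFrame₇CodedOn` DISCHARGED (`abar2 = b₁`) — a block-DIAGONAL real multiplication letter has the same block-`ℓ²` entries as its sup entries
# (pub-ymgap N06 row 13, G side, `L²` member, first of the four displayed ℓ² letter laws)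

T. Bałaban, *Propagators for lattice gauge theories in a background field*, Commun. Math. Phys. **99** (1985) 389–434
[`Balaban1985BackgroundPropagators`, "B9"], (3.24) p. 394, (3.26) p. 395; [4] = T. Bałaban, *Propagators and renormalization transformations for lattice gauge
theories. II*, Commun. Math. Phys. **96** (1984) 223–250 [`Balaban1984PropagatorsII`], (2.20) p. 226, Prop. 2.6 (2.140) p. 247.

statement-level skeleton of published theorems with citation tags; proofs where landed; nothing here is a claim about the Yang–Mills mass gap

WHY THIS FILE (seat dag-n06-c gen 14).  gen 14's `B9SectBL2GFrameCodedY.l2GFrame₇CodedOn` displays four printed letter laws in block-`ℓ²`; the weight letter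
`abC = conj b (ab(U) read on fine bonds)` (`abVY = ext ∘ diag(w∕vol) ∘ res`) is multiplication by the real scalar `w_ι∕vol(ι) ≦ b₁ℓ(ι)⁻²` at the representative
bonds and `0` elsewhere, so `conj b abC` is DIAGONAL in the real coordinates: §1 a generic block-`ℓ²` lemma for diagonal real letters (`hasL2Majorant_of_diag`),
§2 `conj_abC_apply` (the diagonal form) and ★ `hasL2Majorant_abC` (`abC ≺₂ 𝟙[a = a′]·b₁·ℓ(a)⁻²`, no `M₂Σ‖b‖` factor), §3 ★★ `l2SizeAb_gFrame₅CodedOn : L2SizeAb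
(gFrame₅CodedOn …) b₁` — the binder `haL2` of `l2GFrame₇CodedOn` ∕ `stepL2Pos_KACU_frame_on` supplied.

HONEST SCOPE.  Bookkeeping over NODE 00's DEFINED weight letter; no estimate of [B9] asserted.  COUNT-NEUTRAL; N06 NOT discharged; nothing continuum ∕ OS ∕
mass-gap ∕ Clay.  Cell `pub-ymgap` (HUMAN RULING D-0062), Track A node N06 [B9], row 13, 2026-08-29.
-/

noncomputable section

namespace Literature.MathematicalPhysics.QuantumFieldTheory.Balaban1983to89.B9SectBQSizesL2Y

open B6Ineq2142KLevelV1 (β)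
open B6KLevelCensusIndexV1 (KIdx kGeo)
open B6RandomWalk (blockPiece)
open B6RandomWalkL2 (l2n l2n_smul l2n_mono l2n_nonneg HasL2Majorant hasL2Majorant_mono)
open B9Thm34Ext (toB6)
open B9GeoNormsKLevelV1 (geo9K)
open B9Eq352DivFormLetters (conj conj_apply coordEquiv coordEquiv_apply)
open B9PinMembersKLevelV1 (MemberY geo9Y bg9Y)
open B9Eq360DeltaPrimeAY (blkY AfldY)
open B9SectBGpLettersY (GVal blkC)
open B9SectBGpFrameCodedY (codingYx CplxLettersY)
open B9SectBGWordDeltaAY (bondOpCoordsRY bondOpCoordsRY_apply restrictScalars_bondOpCoordsY volY volY_pos abC abVY)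
open B9SectBQSizesY (w_div_volY_le bondFunCoordsY_symm_liftY)
open B9SectBGClassLettersY (Reg335PlaqY CplxLettersGY VarParBY)
open B9SectBGFrameCodedY (gFrame₅CodedOn)
open B9SectBL2GFrameCodedY (L2SizeAb)
open B9RWSumsReadsNbr (nbr)
open Node00 (SiteY BlkY FBondY IBondY CfgY SiteParY BondParY repBondY bondCoordsY bondFunCoordsY GpY XY deltaAY deltaPrimeAY extBondY_apply_repBondY
  extBondY_apply_of_not_mem_range resBondY_apply blkY_repBondY_src liftMatY_diagonal_apply)

variable {d ℓ : ℕ} {hd : 1 ≤ d + 1} {hL : Odd (ℓ + 1) ∧ 1 < ℓ + 1} {b₀ b₁ : ℝ}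
variable {𝔸 : Type} [NormedRing 𝔸] [NormedAlgebra ℂ 𝔸] [CompleteSpace 𝔸]
variable {ι : Type} [Fintype ι]

/-! ## §1 Diagonal real letters in block-`ℓ²` -/

section Diag

variable {g : B6.Geometry} [DecidableEq g.Site] {X : Type} [Fintype X]

/-- ★ **A DIAGONAL REAL LETTER IS A BLOCK-DIAGONAL BLOCK-`ℓ²` LETTER WITH ITS SUP ENTRIES**: if `(T u)(x) = c(x)·u(x)` with `|c(x)| ≦ K(y(x))` (`K ≧ 0`), then
`T ≺₂ 𝟙[a = a′]·K(a)`. [cite: Balaban1984PropagatorsII, Prop. 2.6 (2.140) p.247, (2.51) p.232, bookkeeping] -/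
theorem hasL2Majorant_of_diag (blk : X → g.Site) (T : Module.End ℝ (X → ℝ)) (c : X → ℝ) (K : g.Site → ℝ) (hK : ∀ a, 0 ≤ K a)
    (hT : ∀ u x, T u x = c x * u x) (hc : ∀ x, |c x| ≤ K (blk x)) :
    HasL2Majorant (g := g) blk T (fun a a' => if a = a' then K a else 0) := by
  classical
  intro y y' u hu
  by_cases hyy : y = y'
  · subst hyy
    show _ ≤ (if y = y then K y else 0) * _
    rw [if_pos rfl]
    have hpt : ∀ x, |blockPiece blk y (T u) x| ≤ |(K y • u) x| := by
      intro x
      simp only [blockPiece, Pi.smul_apply, smul_eq_mul]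
      split_ifs with hx
      · rw [hT, abs_mul, abs_mul, abs_of_nonneg (hK y)]
        exact mul_le_mul_of_nonneg_right (by rw [← hx]; exact hc x) (abs_nonneg _)
      · rw [abs_zero]; exact abs_nonneg _
    calc l2n (blockPiece blk y (T u)) ≤ l2n (K y • u) := l2n_mono hpt
      _ = K y * l2n u := by rw [l2n_smul, abs_of_nonneg (hK y)]
  · show _ ≤ (if y = y' then K y else 0) * _
    rw [if_neg hyy, zero_mul]
    have h0 : blockPiece blk y (T u) = 0 := by
      funext x
      simp only [blockPiece, Pi.zero_apply]
      split_ifs with hx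
      · rw [hT, hu x (by rw [hx]; exact hyy), mul_zero]
      · rfl
    rw [h0]
    have : l2n (0 : X → ℝ) = 0 := by
      have h := l2n_smul (0 : ℝ) (0 : X → ℝ)
      rw [zero_smul, abs_zero, zero_mul] at h
      exact h
    rw [this]

end Diag

/-! ## §2 The weight letter `abC` is diagonal; its block-`ℓ²` majorant -/

section Weight

variable (i : KIdx d ℓ hd hL b₀ b₁) (b : Module.Basis ι ℝ 𝔸) (ιB : BlkY i → IBondY i) {Rr : ℝ} {Hp : Prop} [Fintype (geo9K i).Site]
  [DecidableEq (geo9K i).Site]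

open Classical in
/-- the diagonal coefficient of the weight letter read on the coordinate carrier: `w_ι∕vol(ι)` at the representative bond of `ι`, `0` elsewhere.
[cite: Balaban1985BackgroundPropagators, (3.24) p.394, (3.26) p.395, dictionary] -/
def abCoef (q : Fin (d + 1) × SiteY i) : ℝ :=
  if h : (bondCoordsY i).symm q ∈ Set.range (repBondY i) then i.w (Classical.choose h) / volY i (Classical.choose h) else 0

omit [CompleteSpace 𝔸] [Fintype (geo9K i).Site] [DecidableEq (geo9K i).Site] in
/-- ★ `conj b abC` IS DIAGONAL: `(abC u)(q, j) = abCoef(q)·u(q, j)`. [cite: Balaban1985BackgroundPropagators, (3.24) p.394, (3.26) p.395; Balaban1984PropagatorsII, (2.51) p.232] -/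
theorem conj_abC_apply (u : (Fin (d + 1) × SiteY i) × ι → ℝ) (p : (Fin (d + 1) × SiteY i) × ι) :
    abC (𝔸 := 𝔸) i b u p = abCoef i p.1 * u p := by
  classical
  have hQ : abC (𝔸 := 𝔸) i b = conj b (bondOpCoordsRY i ((abVY (𝔸 := 𝔸) i).restrictScalars ℝ)) := by
    rw [abC, restrictScalars_bondOpCoordsY]
  rw [hQ, conj_apply, bondOpCoordsRY_apply, LinearMap.restrictScalars_apply, Node00.bondFunCoordsY_apply]
  -- the coordinates of `(coordEquiv b)⁻¹ u` at `p.1` return `u p`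
  have hrepr : ∀ r : ℝ, b.repr (((r : ℝ) : ℂ) • (coordEquiv b).symm u p.1) p.2 = r * u p := by
    intro r
    rw [Complex.coe_smul, map_smul, Finsupp.smul_apply, smul_eq_mul]
    congr 1
    have h := congrArg (fun v => v p) (LinearEquiv.apply_symm_apply (coordEquiv b) u)
    simpa [coordEquiv_apply] using h
  by_cases hz : (bondCoordsY i).symm p.1 ∈ Set.range (repBondY i)
  · obtain ⟨κ, hκ⟩ := hz
    have hco : abCoef i p.1 = i.w κ / volY i κ := by
      unfold abCoef
      have hz' : (bondCoordsY i).symm p.1 ∈ Set.range (repBondY i) := ⟨κ, hκ⟩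
      rw [dif_pos hz']
      have hc : Classical.choose hz' = κ := Node00.repBondY_injective i ((Classical.choose_spec hz').trans hκ.symm)
      rw [hc]
    rw [hco, ← hκ]
    simp only [abVY, LinearMap.comp_apply, extBondY_apply_repBondY, liftMatY_diagonal_apply, resBondY_apply, Node00.bondFunCoordsY_symm_apply]
    have hq : bondCoordsY i (repBondY i κ) = p.1 := by rw [hκ, Equiv.apply_symm_apply]
    rw [hq]
    exact hrepr _
  · have hco : abCoef i p.1 = 0 := by unfold abCoef; rw [dif_neg hz]
    rw [hco, zero_mul]
    simp only [abVY, LinearMap.comp_apply]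
    rw [extBondY_apply_of_not_mem_range i _ hz, map_zero, Finsupp.zero_apply]

omit [NormedRing 𝔸] [NormedAlgebra ℂ 𝔸] [CompleteSpace 𝔸] [Fintype ι] [Fintype (geo9K i).Site] [DecidableEq (geo9K i).Site] in
/-- the diagonal coefficient is at most `b₁·ℓ(y(q))⁻²` (the index band (2.20): `w_ι∕vol(ι) ≦ b₁ℓ(ι)⁻²`, and the representative bond of `ι` lies in `β ι`).
[cite: Balaban1985BackgroundPropagators, (3.24) p.394; Balaban1984PropagatorsII, (2.20) p.226] -/
theorem abs_abCoef_le (hι : ∀ s : BlkY i, β i.hN i.D i.hk (ιB s) = s) (hb₁ : 0 ≤ b₁) (q : Fin (d + 1) × SiteY i) :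
    |abCoef i q| ≤ b₁ * ((geo9K i).len (blkC i ιB q.2) ^ 2)⁻¹ := by
  classical
  unfold abCoef
  split_ifs with hz
  · set κ := Classical.choose hz with hκdef
    have hκ : repBondY i κ = (bondCoordsY i).symm q := Classical.choose_spec hz
    have hzeq : q = bondCoordsY i (repBondY i κ) := by rw [hκ, Equiv.apply_symm_apply]
    have hz2 : blkC i ιB q.2 = ιB (β i.hN i.D i.hk κ) := by
      rw [hzeq, Node00.bondCoordsY_apply]
      show ιB (blkY i (B6GlobalChartV1.boxEquiv i.hN (repBondY i κ).src)) = _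
      rw [blkY_repBondY_src]
    have hlen : (geo9K i).len (blkC i ιB q.2) = (geo9K i).len κ := by
      rw [hz2]; exact Node00.OpsYRead342.geo9K_len_congr i (hι _)
    rw [abs_of_nonneg (div_nonneg (i.hw κ).le (volY_pos i κ).le), hlen]
    exact w_div_volY_le i κ
  · rw [abs_zero]
    exact mul_nonneg hb₁ (inv_nonneg.2 (sq_nonneg _))

omit [CompleteSpace 𝔸] in
/-- ★ **THE BLOCK-DIAGONAL BLOCK-`ℓ²` MAJORANT OF THE WEIGHT LETTER `ab`**: `abC b ≺₂ 𝟙[a = a′]·b₁·ℓ(a)⁻²` (a diagonal real letter: the `ℓ²` entries are the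
sup entries, no coordinate constant). [cite: Balaban1985BackgroundPropagators, (3.24) p.394, (3.26) p.395; Balaban1984PropagatorsII, Prop. 2.6 (2.140) p.247] -/
theorem hasL2Majorant_abC (hι : ∀ s : BlkY i, β i.hN i.D i.hk (ιB s) = s) (hb₁ : 0 ≤ b₁) :
    HasL2Majorant (g := toB6 (geo9K i) Rr Hp) (fun q : (Fin (d + 1) × SiteY i) × ι => blkC i ιB q.1.2) (abC (𝔸 := 𝔸) i b)
      (fun a a' : (geo9K i).Site => if a = a' then b₁ * ((geo9K i).len a ^ 2)⁻¹ else 0) := by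
  letI : DecidableEq (toB6 (geo9K i) Rr Hp).Site := ‹DecidableEq (geo9K i).Site›
  exact hasL2Majorant_of_diag (g := toB6 (geo9K i) Rr Hp) (fun q : (Fin (d + 1) × SiteY i) × ι => blkC i ιB q.1.2) _
    (fun p => abCoef i p.1) (fun a => b₁ * ((geo9K i).len a ^ 2)⁻¹) (fun a => mul_nonneg hb₁ (inv_nonneg.2 (sq_nonneg _)))
    (conj_abC_apply i b) (fun p => abs_abCoef_le i ιB hι hb₁ p.1)

end Weight

/-! ## §3 ★★ The displayed law `L2SizeAb` of the `L²` frame instance, supplied -/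

section Instance

variable {Mstar : ℕ} [NormOneClass 𝔸] [FiniteDimensional ℝ 𝔸] {J : Type} (f : J → MemberY d ℓ hd hL b₀ b₁ Mstar)
  [∀ x : MemberY d ℓ hd hL b₀ b₁ Mstar, Fintype (geo9Y x).Site]
  [instDS : ∀ x : MemberY d ℓ hd hL b₀ b₁ Mstar, DecidableEq (geo9Y x).Site] [instNE : ∀ x : MemberY d ℓ hd hL b₀ b₁ Mstar, Nonempty (geo9Y x).Site]
  (c35 : ℝ) (G : Subgroup 𝔸ˣ) (par : ∀ j : J, SiteParY 𝔸 (f j).toKIdx) (parB : ∀ j : J, BondParY 𝔸 (f j).toKIdx)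
  [DecidableEq ι] (b : Module.Basis ι ℝ 𝔸) (ιB : ∀ j : J, BlkY (f j).toKIdx → IBondY (f j).toKIdx)
  (C37 C38 : ∀ j : J, ℝ → CfgY 𝔸 (f j).toKIdx → AfldY 𝔸 (f j).toKIdx → Prop)

omit instNE in
/-- ★★ **THE DISPLAYED LAW `L2SizeAb` OF `l2GFrame₇CodedOn` HOLDS WITH `abar2 = b₁`** (the binder `haL2` of `stepL2Pos_KACU_frame_on` supplied).
[cite: Balaban1985BackgroundPropagators, (3.24) p.394, (3.26) p.395; Balaban1984PropagatorsII, (2.20) p.226, Prop. 2.6 (2.140) p.247] -/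
theorem l2SizeAb_gFrame₅CodedOn (hι : ∀ (j : J) (s : BlkY (f j).toKIdx), β (f j).toKIdx.hN (f j).toKIdx.D (f j).toKIdx.hk (ιB j s) = s)
    (hG1 : ∀ u : 𝔸ˣ, u ∈ G → ‖(u : 𝔸)‖ ≤ 1) (hpar : ∀ j (U : CfgY 𝔸 (f j).toKIdx), GVal G (f j).toKIdx U → ∀ z w, par j U z w ∈ G)
    (hunit : ∀ j (U : CfgY 𝔸 (f j).toKIdx), GVal G (f j).toKIdx U → IsUnit (deltaPrimeAY (f j).toKIdx (par j) U))
    (M₂ : ℝ) (hM₂ : 0 ≤ M₂) (hrepr : ∀ (v : 𝔸) (j : ι), |b.repr v j| ≤ M₂ * ‖v‖) (hcR : 0 < M₂ * ∑ j, ‖b j‖)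
    (Cq : ℝ) (hCq : 0 ≤ Cq) (hC37 : ∀ j β' U a, C37 j β' U a → GVal G (f j).toKIdx U ∧ CplxLettersY G (f j) (par j) (ιB j) Cq β' U a)
    (MInv aInv aW : ℝ) (hMInv : 0 < MInv) (haInv : 0 < aInv) (haW : 0 < aW)
    (hunitX : ∀ j (U : CfgY 𝔸 (f j).toKIdx), GVal G (f j).toKIdx U → IsUnit (XY (f j).toKIdx (par j) (GpY (f j).toKIdx (par j)) U))
    (hsym : ∀ j (U : CfgY 𝔸 (f j).toKIdx) (z w : SiteY (f j).toKIdx), par j U z w = (par j U w z)⁻¹)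
    (hunitA : ∀ j (U : CfgY 𝔸 (f j).toKIdx), GVal G (f j).toKIdx U → IsUnit (deltaAY (f j).toKIdx (par j) (parB j) (GpY (f j).toKIdx (par j)) U))
    (hparB : ∀ j (U : CfgY 𝔸 (f j).toKIdx), GVal G (f j).toKIdx U → ∀ y f', parB j U y f' ∈ G) (hb₁ : 0 ≤ b₁)
    (C₀ : ℝ) (hC₀ : 0 ≤ C₀)
    (hreg335P : ∀ j (α₀ : ℝ) (U : CfgY 𝔸 (f j).toKIdx), MInv ≤ (geo9Y (f j)).M → 0 < α₀ → (geo9Y (f j)).M * α₀ ≤ aInv →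
      (bg9Y 𝔸 G (f j)).Reg335 c35 α₀ U → Reg335PlaqY G (f j) (ιB j) C₀ U)
    (hC37G : ∀ j β' U a, C37 j β' U a → CplxLettersGY G (f j) (ιB j) β' U a)
    (cVar : ℝ) (hcVar : 0 ≤ cVar) (hvarB : ∀ j β' U a, C37 j β' U a → VarParBY (f j).toKIdx (parB j) cVar β' U a)
    (hMd : 2 * ((d : ℝ) + 1) < MInv) (mN : ℕ) (hnbr : ∀ (j : J) (y' : IBondY (f j).toKIdx), (nbr (geo9Y (f j)) (2 * ((d : ℝ) + 1)) y').card ≤ mN) :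
    L2SizeAb (gFrame₅CodedOn f c35 G par parB b ιB C37 C38 hι hG1 hpar hunit M₂ hM₂ hrepr hcR Cq hCq hC37 MInv aInv aW hMInv haInv haW hunitX hsym hunitA hparB hb₁ C₀
      hC₀ hreg335P hC37G cVar hcVar hvarB hMd mN hnbr) b₁ := by
  intro j
  letI : Fintype (geo9K (f j).toKIdx).Site := ‹∀ x : MemberY d ℓ hd hL b₀ b₁ Mstar, Fintype (geo9Y x).Site› (f j)
  letI : DecidableEq (geo9K (f j).toKIdx).Site := instDS (f j)
  exact hasL2Majorant_abC (Rr := 0) (Hp := True) (f j).toKIdx b (ιB j) (hι j) hb₁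

end Instance

end Literature.MathematicalPhysics.QuantumFieldTheory.Balaban1983to89.B9SectBQSizesL2Y

end
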